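import Mathlib.Combinatorics.SetFamily.FourFunctions
import Mathlib.Data.Finset.SymmDiff
import Mathlib.Tactic
import HarnessLib
import HarnessLib.Audit.Tags
import Summits.CriticalPhenomena.PercolationContinuityZ3.Theorems.PercNearOneGluingNoHeavyLowerTailSahiMSWitness
import Summits.CriticalPhenomena.PercolationContinuityZ3.Theorems.PercNearOneGluingNoHeavyLowerTailSahiMSSlices
import Summits.CriticalPhenomena.PercolationContinuityZ3.Theorems.PercNearOneGluingNoHeavyLowerTailSahiMSNested
import Summits.CriticalPhenomena.PercolationContinuityZ3.Theorems.PercNearOneGluingNoHeavyLowerTailSahiMSRigid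
import Summits.CriticalPhenomena.PercolationContinuityZ3.Theorems.PercNearOneGluingNoHeavyLowerTailSahiColouredDaykinCrossSingleton

/-!
# Equality in the Marica–Schönheim inequality, V: the characterisation, the strict inequality for disconnected families, and the
# singleton-class case of the crossing signed coloured Daykin inequality

Support file (seat `prim-masterthm-p1`, gen 29; `--supports stmt-CriticalPhenomena-4575`).  No `sorry`, no new definitions, standard axioms.
Memo `run/shared/lean/prim/prim-masterthm/FROM-prim-masterthm-p1-g29-MS-EQUALITY.md`, Theorem 6 and Corollaries 7–9.

* `card_diffs_eq_card_iff` — **THEOREM (cases of equality in Marica–Schönheim): `#(Q \\ Q) = #Q ↔ ∃ M, Q \\ Q = {C △ M : C ∈ Q}`.**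
  Induction on the ground set: at a point `r` the slices are trivial, or rigid (then `…SahiMSRigid.slices_coordinate`: `r` has a twin),
  or nested (`…SahiMSNested.slices_nested`), and in each case a witness of `Q` is assembled from witnesses of the slices
  (`…SahiMSNested.IsWitness.common_union/common_inter`).  An Aharoni–Holzman-type theorem [J. LMS 48 (1993); paper not held —
  statement and proof here are independent].
* `exists_hub_of_card_diffs_eq` — equality ⟹ some member `M` has `C ∪ M, C ∩ M ∈ Q` for all members `C` (connected comparability graph).
* `card_add_card_add_one_le_card_diffs` and **`strictMaricaSchonheim : StrictMaricaSchonheim α`** — the gen-28 conjecture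
  (`…SahiColouredDaykinCrossSingleton`) is a THEOREM: Marica–Schönheim is strict for families with disconnected comparability graph.
* `card_le_card_compatJoins_cross_of_singleton'`, `card_le_card_compatJoins_cross_two_colours'` — hence, UNCONDITIONALLY: a crossing
  two-colour configuration has slack one, and **`CrossSignedColouredDaykin3` holds for every crossing configuration with a singleton
  colour class** (all petal-derived configurations on `2^5`; memo gen 28 §17).  The general crossing conjecture stays OPEN. [this work]
-/

namespace Summit.CriticalPhenomena.PercolationContinuityZ3.Theorems.SahiMSEquality

open Finset
open scoped FinsetFamily symmDiff

variable {α : Type*} [DecidableEq α]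

/-! ### 8. The characterisation of equality (memo Theorem 6) -/

section Main

/-- Level-1 differences contain the split point `x`, level-0 differences do not (coordinate-split case). [this work] -/
private theorem mem_slice_diffs_of_coordinate {Q : Finset (Finset α)} {r x : α}
    (hx₁ : ∀ h ∈ slice₁ Q r, x ∈ h) (hx₀ : ∀ l ∈ slice₀ Q r, x ∉ l) {X : Finset α}
    (hX : X ∈ (slice₀ Q r ∪ slice₁ Q r) \\ (slice₀ Q r ∪ slice₁ Q r)) :
    (x ∈ X → X ∈ slice₁ (Q \\ Q) r) ∧ (x ∉ X → X ∈ slice₀ (Q \\ Q) r) := by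
  have hU := slice₀_diffs_union_slice₁_diffs Q r
  have hXU : X ∈ slice₀ (Q \\ Q) r ∪ slice₁ (Q \\ Q) r := by rw [hU]; exact hX
  have hA := slice₀_diffs Q r
  have hB := slice₁_diffs Q r
  constructor
  · intro hxX
    refine (mem_union.1 hXU).resolve_left fun h0 => ?_
    rw [hA] at h0
    rcases mem_union.1 h0 with h0 | h0
    · obtain ⟨l, hl, p, _, rfl⟩ := mem_diffs.1 h0
      exact hx₀ l hl (mem_sdiff.1 hxX).1
    · obtain ⟨h, _, h', hh', rfl⟩ := mem_diffs.1 h0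
      exact (mem_sdiff.1 hxX).2 (hx₁ h' hh')
  · intro hxX
    refine (mem_union.1 hXU).resolve_right fun h1 => ?_
    rw [hB] at h1
    obtain ⟨h, hh, l, hl, rfl⟩ := mem_diffs.1 h1
    exact hxX (mem_sdiff.2 ⟨hx₁ h hh, hx₀ l hl⟩)

/-- **Theorem W (with an explicit ground set, for the induction).** [this work] -/
theorem exists_isWitness_aux : ∀ (n : ℕ) (F : Finset α) (Q : Finset (Finset α)),
    #F = n → (∀ C ∈ Q, C ⊆ F) → #(Q \\ Q) = #Q → ∃ M, IsWitness Q M := by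
  intro n
  induction n with
  | zero =>
    intro F Q hF hQF hQ
    have hF0 : F = ∅ := card_eq_zero.1 hF
    -- every member is empty: Q ⊆ {∅}; witness ∅
    refine ⟨∅, isWitness_of_image_subset ?_ hQ⟩
    intro X hX
    obtain ⟨C, hC, rfl⟩ := mem_image.1 hX
    have hC0 : C = ∅ := subset_empty.1 (hF0 ▸ hQF C hC)
    subst hC0
    have e : (∅ : Finset α) ∆ ∅ = ∅ \ ∅ := by simp
    simpa [e] using sdiff_mem_diffs hC hC
  | succ n ih =>
    intro F Q hF hQF hQ
    obtain ⟨r, hr⟩ : F.Nonempty := by rw [← card_pos, hF]; exact Nat.succ_pos n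
    have hFr : #(F.erase r) = n := by rw [card_erase_of_mem hr, hF]; rfl
    have hPF : ∀ C ∈ slice₀ Q r ∪ slice₁ Q r, C ⊆ F.erase r := fun C hC => subset_erase_of_mem_slice hQF hC
    have hcardQ := card_eq_card_slice₀_add_card_slice₁ Q r
    have hcardD := card_eq_card_slice₀_add_card_slice₁ (Q \\ Q) r
    have hA := slice₀_diffs Q r
    have hB := slice₁_diffs Q r
    obtain ⟨hPe, hTe, hAB⟩ := slices_of_card_diffs_eq Q r hQ
    set s₀ := slice₀ Q r with hs₀
    set s₁ := slice₁ Q r with hs₁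
    -- `r` lies in no member of the slices
    have hr₀ : ∀ C ∈ s₀, r ∉ C := fun C hC => (mem_slice₀.1 hC).2
    have hr₁ : ∀ C ∈ s₁, r ∉ C := fun C hC => (mem_slice₁.1 hC).1
    -- how a member of Q looks
    have hQcases : ∀ C ∈ Q, (r ∉ C ∧ C ∈ s₀) ∨ (r ∈ C ∧ C.erase r ∈ s₁) := by
      intro C hC
      by_cases hrC : r ∈ C
      · exact Or.inr ⟨hrC, erase_mem_slice₁ hrC hC⟩
      · exact Or.inl ⟨hrC, mem_slice₀.2 ⟨hC, hrC⟩⟩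
    -- translating a member containing r
    have symmDiff_insert : ∀ (C N : Finset α), r ∈ C → r ∉ N → C ∆ insert r N = (C.erase r) ∆ N := by
      intro C N hrC hrN; ext y; simp only [mem_symmDiff, mem_insert, mem_erase]
      constructor
      · rintro (⟨hyC, hy⟩ | ⟨hy, hyC⟩)
        · exact Or.inl ⟨⟨fun e => hy (Or.inl e), hyC⟩, fun hyN => hy (Or.inr hyN)⟩
        · rcases hy with rfl | hyN
          · exact absurd hrC hyC
          · exact Or.inr ⟨hyN, fun h => hyC h.2⟩
      · rintro (⟨⟨hyr, hyC⟩, hyN⟩ | ⟨hyN, hy⟩)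
        · exact Or.inl ⟨hyC, fun h => h.elim hyr hyN⟩
        · refine Or.inr ⟨Or.inr hyN, fun hyC => hy ⟨fun e => hrN (e ▸ hyN), hyC⟩⟩
    have symmDiff_notMem : ∀ (C N : Finset α), r ∈ C → r ∉ N → C ∆ N = insert r ((C.erase r) ∆ N) := by
      intro C N hrC hrN; ext y; simp only [mem_symmDiff, mem_insert, mem_erase]
      constructor
      · rintro (⟨hyC, hyN⟩ | ⟨hyN, hyC⟩)
        · by_cases e : y = r
          · exact Or.inl e
          · exact Or.inr (Or.inl ⟨⟨e, hyC⟩, hyN⟩)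
        · exact Or.inr (Or.inr ⟨hyN, fun h => hyC h.2⟩)
      · rintro (rfl | ⟨⟨_, hyC⟩, hyN⟩ | ⟨hyN, hy⟩)
        · exact Or.inl ⟨hrC, hrN⟩
        · exact Or.inl ⟨hyC, hyN⟩
        · exact Or.inr ⟨hyN, fun hyC => hy ⟨fun e => hrN (e ▸ hyN), hyC⟩⟩
    have insert_symmDiff : ∀ (C N : Finset α), r ∉ C → r ∉ N → C ∆ insert r N = insert r (C ∆ N) := by
      intro C N hrC hrN; ext y; simp only [mem_symmDiff, mem_insert]
      constructor
      · rintro (⟨hyC, hy⟩ | ⟨hy, hyC⟩)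
        · exact Or.inr (Or.inl ⟨hyC, fun hyN => hy (Or.inr hyN)⟩)
        · rcases hy with rfl | hyN
          · exact Or.inl rfl
          · exact Or.inr (Or.inr ⟨hyN, hyC⟩)
      · rintro (rfl | ⟨hyC, hyN⟩ | ⟨hyN, hyC⟩)
        · exact Or.inr ⟨Or.inl rfl, hrC⟩
        · exact Or.inl ⟨hyC, fun h => h.elim (fun e => hrC (e ▸ hyC)) hyN⟩
        · exact Or.inr ⟨Or.inr hyN, hyC⟩
    -- membership of slices of Q \\ Q in Q \\ Q
    have memD₀ : ∀ X ∈ slice₀ (Q \\ Q) r, X ∈ Q \\ Q := fun X hX => (mem_slice₀.1 hX).1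
    have memD₁ : ∀ X ∈ slice₁ (Q \\ Q) r, insert r X ∈ Q \\ Q := fun X hX => (mem_slice₁.1 hX).2
    by_cases h₁ : s₁ = ∅
    · -- r in no member: Q lives on F.erase r
      refine ih (F.erase r) Q hFr (fun C hC => ?_) hQ
      rcases hQcases C hC with ⟨_, hC0⟩ | ⟨_, hC1⟩
      · exact hPF C (mem_union.2 (Or.inl hC0))
      · rw [h₁] at hC1; exact absurd hC1 (notMem_empty _)
    by_cases h₀ : s₀ = ∅
    · -- r in every member: Q ≅ s₁
      have hD : #(s₁ \\ s₁) = #s₁ := by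
        have e0 : slice₀ (Q \\ Q) r = s₁ \\ s₁ := by rw [hA, h₀]; simp
        have e1 : slice₁ (Q \\ Q) r = ∅ := by rw [hB, h₀]; simp
        rw [e0, e1, card_empty, add_zero] at hcardD
        rw [h₀, card_empty, zero_add] at hcardQ
        rw [← hcardD, ← hcardQ, hQ]
      obtain ⟨M₁, hM₁⟩ := ih (F.erase r) s₁ hFr (fun C hC => hPF C (mem_union.2 (Or.inr hC))) hD
      have hrM₁ : r ∉ M₁ := hr₁ M₁ (hM₁.mem (nonempty_iff_ne_empty.2 h₁))
      refine ⟨insert r M₁, isWitness_of_image_subset ?_ hQ⟩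
      intro X hX
      obtain ⟨C, hC, rfl⟩ := mem_image.1 hX
      rcases hQcases C hC with ⟨_, hC0⟩ | ⟨hrC, hC1⟩
      · rw [h₀] at hC0; exact absurd hC0 (notMem_empty _)
      · rw [symmDiff_insert C M₁ hrC hrM₁]
        apply memD₀
        rw [hA, h₀]
        simp only [empty_sdiffs, empty_union]
        exact hM₁.symmDiff_mem_diffs hC1
    -- both slices non-empty
    have hne₀ : s₀.Nonempty := nonempty_iff_ne_empty.2 h₀
    have hne₁ : s₁.Nonempty := nonempty_iff_ne_empty.2 h₁
    obtain ⟨MP, hMP⟩ := ih (F.erase r) (s₀ ∪ s₁) hFr hPF hPe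
    have hrMP : r ∉ MP := by
      have := hMP.mem (hne₀.mono subset_union_left)
      rcases mem_union.1 this with h | h
      · exact hr₀ _ h
      · exact hr₁ _ h
    by_cases hT : s₀ ∩ s₁ = ∅
    · -- rigid point: coordinate split at some x
      obtain ⟨x, hx₁, hx₀⟩ := slices_coordinate hQ hT hne₀ hne₁ hMP
      by_cases hxM : x ∈ MP
      · refine ⟨insert r MP, isWitness_of_image_subset ?_ hQ⟩
        intro X hX
        obtain ⟨C, hC, rfl⟩ := mem_image.1 hX
        rcases hQcases C hC with ⟨hrC, hC0⟩ | ⟨hrC, hC1⟩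
        · rw [insert_symmDiff C MP hrC hrMP]
          apply memD₁
          have hD : C ∆ MP ∈ (s₀ ∪ s₁) \\ (s₀ ∪ s₁) := hMP.symmDiff_mem_diffs (mem_union.2 (Or.inl hC0))
          exact (mem_slice_diffs_of_coordinate hx₁ hx₀ hD).1
            (mem_symmDiff.2 (Or.inr ⟨hxM, hx₀ C hC0⟩))
        · rw [symmDiff_insert C MP hrC hrMP]
          apply memD₀
          have hD : C.erase r ∆ MP ∈ (s₀ ∪ s₁) \\ (s₀ ∪ s₁) := hMP.symmDiff_mem_diffs (mem_union.2 (Or.inr hC1))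
          refine (mem_slice_diffs_of_coordinate hx₁ hx₀ hD).2 fun hxX => ?_
          rcases mem_symmDiff.1 hxX with ⟨_, h⟩ | ⟨_, h⟩
          · exact h hxM
          · exact h (hx₁ _ hC1)
      · refine ⟨MP, isWitness_of_image_subset ?_ hQ⟩
        intro X hX
        obtain ⟨C, hC, rfl⟩ := mem_image.1 hX
        rcases hQcases C hC with ⟨hrC, hC0⟩ | ⟨hrC, hC1⟩
        · apply memD₀
          have hD : C ∆ MP ∈ (s₀ ∪ s₁) \\ (s₀ ∪ s₁) := hMP.symmDiff_mem_diffs (mem_union.2 (Or.inl hC0))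
          refine (mem_slice_diffs_of_coordinate hx₁ hx₀ hD).2 fun hxX => ?_
          rcases mem_symmDiff.1 hxX with ⟨h, _⟩ | ⟨h, _⟩
          · exact hx₀ C hC0 h
          · exact hxM h
        · rw [symmDiff_notMem C MP hrC hrMP]
          apply memD₁
          have hD : C.erase r ∆ MP ∈ (s₀ ∪ s₁) \\ (s₀ ∪ s₁) := hMP.symmDiff_mem_diffs (mem_union.2 (Or.inr hC1))
          exact (mem_slice_diffs_of_coordinate hx₁ hx₀ hD).1
            (mem_symmDiff.2 (Or.inl ⟨hx₁ _ hC1, hxM⟩))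
    -- non-rigid point: nested slices
    have hTne : (s₀ ∩ s₁).Nonempty := nonempty_iff_ne_empty.2 hT
    obtain ⟨MT, hMT⟩ := ih (F.erase r) (s₀ ∩ s₁) hFr (fun C hC => hPF C (mem_union.2 (Or.inl (mem_inter.1 hC).1))) hTe
    rcases slices_nested hQ hTne hMT with hsub | hsub
    · -- s₀ ⊆ s₁ : P = s₁, T = s₀; common witness MT ∪ MP, final witness insert r (MT ∪ MP)
      have hP : s₀ ∪ s₁ = s₁ := union_eq_right.2 hsub
      have hTeq : s₀ ∩ s₁ = s₀ := inter_eq_left.2 hsub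
      rw [hP] at hMP
      rw [hTeq] at hMT
      have hK : s₁ \\ s₀ ⊆ s₀ \\ s₀ := by
        intro X hX
        have h1 : X ∈ slice₁ (Q \\ Q) r := by rw [hB]; exact hX
        have h0 : X ∈ slice₀ (Q \\ Q) r := by
          rw [hA]; exact mem_union.2 (Or.inr (diffs_subset_left hsub hX))
        have := mem_inter.2 ⟨h0, h1⟩
        rwa [hAB, hTeq] at this
      obtain ⟨hW₀, hW₁⟩ := hMT.common_union hMP hsub hne₀ hK
      have hrM : r ∉ MT ∪ MP := by
        rw [mem_union, not_or]; exact ⟨hr₀ _ (hMT.mem hne₀), hrMP⟩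
      refine ⟨insert r (MT ∪ MP), isWitness_of_image_subset ?_ hQ⟩
      intro X hX
      obtain ⟨C, hC, rfl⟩ := mem_image.1 hX
      rcases hQcases C hC with ⟨hrC, hC0⟩ | ⟨hrC, hC1⟩
      · rw [insert_symmDiff C _ hrC hrM]
        apply memD₁
        have : C ∆ (MT ∪ MP) ∈ s₀ \\ s₀ := hW₀.symmDiff_mem_diffs hC0
        rw [← hTeq, ← hAB] at this
        exact (mem_inter.1 this).2
      · rw [symmDiff_insert C _ hrC hrM]
        apply memD₀
        rw [hA]
        exact mem_union.2 (Or.inr (hW₁.symmDiff_mem_diffs hC1))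
    · -- s₁ ⊆ s₀ : P = s₀, T = s₁; common witness MT ∩ MP, final witness MT ∩ MP
      have hP : s₀ ∪ s₁ = s₀ := union_eq_left.2 hsub
      have hTeq : s₀ ∩ s₁ = s₁ := inter_eq_right.2 hsub
      rw [hP] at hMP
      rw [hTeq] at hMT
      have hK : s₁ \\ s₀ ⊆ s₁ \\ s₁ := by
        intro X hX
        have h1 : X ∈ slice₁ (Q \\ Q) r := by rw [hB]; exact hX
        have h0 : X ∈ slice₀ (Q \\ Q) r := by
          rw [hA]; exact mem_union.2 (Or.inl (diffs_subset hsub subset_union_left hX))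
        have := mem_inter.2 ⟨h0, h1⟩
        rwa [hAB, hTeq] at this
      obtain ⟨hW₁, hW₀⟩ := hMT.common_inter hMP hsub hne₁ hK
      have hrM : r ∉ MT ∩ MP := fun h => hrMP (mem_inter.1 h).2
      refine ⟨MT ∩ MP, isWitness_of_image_subset ?_ hQ⟩
      intro X hX
      obtain ⟨C, hC, rfl⟩ := mem_image.1 hX
      rcases hQcases C hC with ⟨hrC, hC0⟩ | ⟨hrC, hC1⟩
      · apply memD₀
        rw [hA, hP]
        exact mem_union.2 (Or.inl (hW₀.symmDiff_mem_diffs hC0))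
      · rw [symmDiff_notMem C _ hrC hrM]
        apply memD₁
        have : C.erase r ∆ (MT ∩ MP) ∈ s₁ \\ s₁ := hW₁.symmDiff_mem_diffs hC1
        rw [← hTeq, ← hAB] at this
        exact (mem_inter.1 this).2

/-- **THEOREM (the cases of equality in the Marica–Schönheim inequality).**  A finite family of finite sets has exactly as many
differences as members iff its difference family is a symmetric-difference translate of the family:
`#(Q \\ Q) = #Q ↔ ∃ M, Q \\ Q = {C △ M : C ∈ Q}`.  (Aharoni–Holzman 1993 proved a characterisation of the equality cases; their
paper was not available to us and this statement and proof are independent.) [this work] -/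
theorem card_diffs_eq_card_iff (Q : Finset (Finset α)) : #(Q \\ Q) = #Q ↔ ∃ M, IsWitness Q M := by
  constructor
  · intro hQ
    exact exists_isWitness_aux _ (Q.sup id) Q rfl (fun C hC => Finset.le_sup (f := id) hC) hQ
  · rintro ⟨M, hM⟩; exact hM.card_diffs

/-- **Corollary (hub).**  In a non-empty equality family there is a member `M` with `C ∪ M ∈ Q` and `C ∩ M ∈ Q` for every member
`C`; in particular the comparability graph of `Q` is connected (every member is joined to `M` through `C ∪ M`). [this work] -/
theorem exists_hub_of_card_diffs_eq (Q : Finset (Finset α)) (hQ : #(Q \\ Q) = #Q) (hne : Q.Nonempty) :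
    ∃ M ∈ Q, ∀ C ∈ Q, C ∪ M ∈ Q ∧ C ∩ M ∈ Q := by
  obtain ⟨M, hM⟩ := (card_diffs_eq_card_iff Q).1 hQ
  exact ⟨M, (exists_hub_of_isWitness hM hne).1, (exists_hub_of_isWitness hM hne).2⟩

/-- **Corollary (strict Marica–Schönheim for disconnected families).**  If `𝒜, ℬ` are non-empty and no member of `𝒜` is comparable
with a member of `ℬ`, then `#𝒜 + #ℬ + 1 ≤ #((𝒜 ∪ ℬ) \\ (𝒜 ∪ ℬ))`. [this work] -/
theorem card_add_card_add_one_le_card_diffs (𝒜 ℬ : Finset (Finset α)) (h𝒜 : 𝒜.Nonempty) (hℬ : ℬ.Nonempty)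
    (hinc : ∀ a ∈ 𝒜, ∀ b ∈ ℬ, ¬ a ⊆ b ∧ ¬ b ⊆ a) : #𝒜 + #ℬ + 1 ≤ #((𝒜 ∪ ℬ) \\ (𝒜 ∪ ℬ)) := by
  have hdisj : Disjoint 𝒜 ℬ := by
    rw [disjoint_left]; intro a ha hb; exact (hinc a ha a hb).1 Subset.rfl
  have hcard : #(𝒜 ∪ ℬ) = #𝒜 + #ℬ := card_union_of_disjoint hdisj
  have hMS : #(𝒜 ∪ ℬ) ≤ #((𝒜 ∪ ℬ) \\ (𝒜 ∪ ℬ)) := Finset.card_le_card_diffs _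
  rw [hcard] at hMS
  by_contra hlt
  have heq : #((𝒜 ∪ ℬ) \\ (𝒜 ∪ ℬ)) = #(𝒜 ∪ ℬ) := by omega
  obtain ⟨M, hM, hhub⟩ := exists_hub_of_card_diffs_eq _ heq (h𝒜.mono subset_union_left)
  rcases mem_union.1 hM with hM𝒜 | hMℬ
  · obtain ⟨b, hb⟩ := hℬ
    have hbM := (hhub b (mem_union.2 (Or.inr hb))).1
    rcases mem_union.1 hbM with h | h
    · exact (hinc _ h b hb).2 subset_union_left
    · exact (hinc M hM𝒜 _ h).1 subset_union_right
  · obtain ⟨a, ha⟩ := h𝒜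
    have haM := (hhub a (mem_union.2 (Or.inl ha))).1
    rcases mem_union.1 haM with h | h
    · exact (hinc _ h M hMℬ).2 subset_union_right
    · exact (hinc a ha _ h).1 subset_union_left

end Main

/-! ### 9. Consequences for the coloured Daykin programme -/

section Bridge

/-- **The strict Marica–Schönheim inequality for disconnected families (gen-28 conjecture `StrictMaricaSchonheim`) holds.** [this work] -/
theorem strictMaricaSchonheim : SahiColouredDaykin.StrictMaricaSchonheim α :=
  fun 𝒜 ℬ h𝒜 hℬ hinc => card_add_card_add_one_le_card_diffs 𝒜 ℬ h𝒜 hℬ hinc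

/-- **Two colours, crossing ⟹ slack one — unconditionally.** [this work] -/
theorem card_le_card_compatJoins_cross_two_colours' (F : Finset α) (P : Finset (Finset α)) (c : Finset α → Fin 3)
    (i j : Fin 3) (hij : i ≠ j) (hPF : ∀ S ∈ P, S ⊆ F) (hcol : ∀ S ∈ P, c S = i ∨ c S = j)
    (hi : ∃ S ∈ P, c S = i) (hj : ∃ S ∈ P, c S = j)
    (hcross : ∀ S ∈ P, ∀ T ∈ P, (S ∩ T).Nonempty ∧ S ∪ T ≠ F) :
    #P + 1 ≤ #(SahiColouredDaykin.compatJoins F P c) :=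
  SahiColouredDaykin.card_le_card_compatJoins_cross_two_colours strictMaricaSchonheim F P c i j hij hPF hcol hi hj hcross

/-- **`CrossSignedColouredDaykin3` for configurations with a singleton colour class — unconditionally.**  A crossing three-colour
configuration in which some colour occurs exactly once satisfies `#P ≤ #compatJoins`. [this work] -/
theorem card_le_card_compatJoins_cross_of_singleton' (F : Finset α) (P : Finset (Finset α)) (c : Finset α → Fin 3) (i : Fin 3)
    (hPF : ∀ S ∈ P, S ⊆ F) (hcross : ∀ S ∈ P, ∀ T ∈ P, (S ∩ T).Nonempty ∧ S ∪ T ≠ F)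
    (hone : #(P.filter fun S => c S = i) = 1) (hall : ∀ j : Fin 3, ∃ S ∈ P, c S = j) :
    #P ≤ #(SahiColouredDaykin.compatJoins F P c) :=
  SahiColouredDaykin.card_le_card_compatJoins_cross_of_singleton strictMaricaSchonheim F P c i hPF hcross hone hall

end Bridge

end Summit.CriticalPhenomena.PercolationContinuityZ3.Theorems.SahiMSEquality
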